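/-
Copyright: statement-level skeleton of a published paper (lit-balaban cell, Phase-2 proof seat p26 gen 44). No claims beyond
what the kernel checks below.
-/
import Mathlib
import Literature.MathematicalPhysics.QuantumFieldTheory.Balaban1983to89.B3Eq326FromFeynmanRules

/-!
# B3 — T. Bałaban, *(Higgs)₂,₃ quantum fields in a finite volume. III. Renormalization*, CMP **88** (1983) 411–445
[Balaban1983Higgs3] — p. 426 [PDF 16], (2.10)/(2.11): **THE KERNEL OF A DIFFERENTIATED φ′-LINE IS THE COVARIANT DERIVATIVE OF
THE PROPAGATOR** — FILE 6's effective line kernels `dK1`, `dK2` (one differentiated leg of (1.8)/(1.9)) and FILE 5's `dKs` (both legs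
differentiated), defined in the INDEX FORM of the evaluator as `Σ_p K(p, r)·[(D^η_B̃ δ_p)(b)·u]`, are identified with the covariant
derivative (I.1.7) of the propagator's column ∕ row FIELD at the bond: `dK1 K (b, u; r) = (D^η_B̃ K(·, r))(b)·u` — the object print
bounds in (2.10)/(2.11) (*"if the propagator is differentiated, then for each differentiation, there is an additional factor
(L^jη)^{−1} on the right side"*; the typer's `B3Sect2StatementsPart2.ScaledKernels.absDG` = |(D^η_{B̃,μ}G^η_{(j)})(Ω,B̃;x,x′)|).  Hence
`|dK1 K (b, u; r)| ≤ ‖(D^η_B̃ K(·, r))(b)‖·‖u‖`: the line hypotheses of the signed position form (FILE 14 of the evaluator lineage,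
`B3GraphAmplitudeSignedPositionForm`, staged) are fed by (2.10)+(2.11) exactly as printed (FILE 15 of the evaluator lineage; item 5(i)
of `HOME/lit-balaban-p26/DESIGN-B3-evaluator.md`, the differentiated-line half).

statement-level skeleton of published theorems with citation tags; proofs where landed; nothing here is a claim about
the Yang–Mills mass gap

PDF held: `paper:balaban1983-higgs-2-3-quantum-fields-finite-volume` (journal page = PDF page + 410); p. 426 [PDF 16] read by this
seat on the text layer `~/.lit/texts/paper-balaban1983-higgs-2-3-quantum-fields-finite-volume/p0016.txt` (2026-08-24).

CITATION HEADER (lean-in-tree rule).  lit-balaban TYPED SKELETON (HOME `run/shared/lean/pub/lit-balaban/`), PHASE 2, seat p26 gen 44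
(unit `lit-balaban-p26`; free-target protocol G.5-34(d), own lane; the evaluator lineage FILE 1 `B3GraphAmplitude` p361338, FILE 2
`B3GraphAmplitudeRules` p362438, FILE 5 `B3Eq39FromFeynmanRules` p365665, FILE 6 `B3Eq326FromFeynmanRules`).  ROWS **B3.Eq2.10-2.12**
((2.10)–(2.12) p. 426; heads by the B3Ineq210*/211* files) and **B3.Eq2.13-2.14** of `HOME/lit-balaban-r15/ROWS-B3.md` (fold owner r15;
cells only — an OPTIONAL located member, zero head weight).  CONSUMES BY NAME, nothing re-declared: FILE 6's `dK1`, `dK2`,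
`dK1_zero_free`, `dK2_zero_free`, `dKs_zero_free2`, `dKernelL`, `dKernelR`, `d2KernelT`, FILE 5's `dKs`, FILE 2's `basisE`,
`sum_coord_smul_basisE`, the typer's `HiggsLattice.{Site, PBond, PBond.src, PBond.tgt, ScalarField, VecField, ChargeData, ChargeData.U,
covDeriv, covDeriv_zero, sderiv, mesh}`, Mathlib's `EuclideanSpace.inner_single_left/right`, `PiLp.single_apply`, `WithLp.toLp`.

READING (declared).  For a line kernel `K` on `(T_η × {1..N})²` (the entries `K (x,a) (x′,a′) = e_a·G(x,x′)e_{a′}` of a propagator or of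
a (2.6) piece) its COLUMN FIELD at the index `r` is the `ℝ^N`-valued lattice field `x ↦ (a ↦ K((x,a), r))` and its ROW FIELD at `r` is
`x′ ↦ (a′ ↦ K(r, (x′,a′)))`; both are written inline as `fun x => WithLp.toLp 2 (fun a => …)` (no new definition).  **`dK1_eq_inner_covDeriv`**:
`dK1 K (b, u; r) = ⟪(D^η_B̃ col_r K)(b), u⟫`; **`dK2_eq_inner_covDeriv`**: `dK2 K (r; b′, u′) = ⟪(D^η_B̃ row_r K)(b′), u′⟫`;
**`dKs_eq_sum_dK2`** and **`dKs_eq_inner_covDeriv`**: `dKs K (b, u; b′, u′) = ⟪(D^η_B̃ [x ↦ (a ↦ dK2 K ((x,a); b′, u′))])(b), u⟫` (the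
covariant derivative in the first variable of the field of covariant derivatives in the second); the Cauchy–Schwarz corollaries
**`abs_dK1_le`**, **`abs_dK2_le`**, **`abs_dKs_le`** (`|dK1| ≤ ‖(D col)(b)‖‖u‖` etc.), and the linearity lemma `covDeriv_sum_smul_basisE`
they rest on; the explicit covariant forward difference `dK1_single_eq` (`η⁻¹((U(ηB̃_b)K((b₊,·),r))_c − K((b₋,c),r))`); and at
ZERO background with the free kernel `G ⊗ 1_N` (the data of FILEs 5–7, 13): **`abs_dK1_zero_free_le`**, `abs_dK2_zero_free_le`,
`abs_dKs_zero_free_le` — the signed form's line hypotheses are met by bounds on FILE 6's difference quotients `dKernelL` ∕ `dKernelR` ∕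
`d2KernelT` of the scalar propagator (forward differences at `b₋ = x`, the convention of p19's `B3Ineq213ZeroBoxDiffLines.dlineK`).
HONEST SCOPE: identities and Cauchy–Schwarz only; identifying `‖(D^η_B̃ col_{(x′,c′)} G^η_{(j)})(b)‖` with the `absDG` ∕
`holderDiff` fields of a CONCRETE `ScaledKernels` instance of the tree (B3Ineq210ZeroTorus, B3Ineq211RegularTorus, …) is instance-specific
and NOT done here (those instances live on the scalar torus tower's carrier `Setup`/`Site`, the evaluator on `HiggsLattice.Site`: a
carrier bridge is part of that work).  Unit `lit-balaban-p26` gen 44 (literature-prover-lit-balaban-p26-g44-0), HOME `run/shared/lean/pub/lit-balaban/`,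
2026-08-24.
-/

open Finset
open scoped BigOperators InnerProductSpace

namespace Literature.MathematicalPhysics.QuantumFieldTheory.Balaban1983to89.B3DifferentiatedLineKernels

open Literature.MathematicalPhysics.QuantumFieldTheory.Balaban1983to89.HiggsLattice (ChargeData covDeriv)
open Literature.MathematicalPhysics.QuantumFieldTheory.Balaban1983to89.B3GraphAmplitude
open Literature.MathematicalPhysics.QuantumFieldTheory.Balaban1983to89.B3GraphAmplitudeRules
open Literature.MathematicalPhysics.QuantumFieldTheory.Balaban1983to89.B3Eq39FromFeynmanRules (dKs)
open Literature.MathematicalPhysics.QuantumFieldTheory.Balaban1983to89.B3Eq326FromFeynmanRules (dK1 dK2)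

noncomputable section

variable {P : HiggsLattice.Params} {N : ℕ}

/-- **The covariant derivative is linear in the field**: on a finite linear combination of basis fields,
`(D^η_B̃ Σ_p c_p δ_p)(b) = Σ_p c_p (D^η_B̃ δ_p)(b)`. [cite: Balaban1982Higgs1, (1.7) p.605] -/
theorem covDeriv_sum_smul_basisE (C : ChargeData N) (B : HiggsLattice.VecField P 0) (c : HiggsLattice.Site P 0 × Fin N → ℝ)
    (b : HiggsLattice.PBond P 0) :
    covDeriv C B (∑ p, c p • basisE p) b = ∑ p, c p • covDeriv C B (basisE p) b := by
  unfold covDeriv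
  simp only [Finset.sum_apply, Pi.smul_apply, map_sum, map_smul, smul_sub, Finset.sum_sub_distrib, Finset.smul_sum]
  congr 1
  · exact Finset.sum_congr rfl fun p _ => smul_comm _ _ _
  · exact Finset.sum_congr rfl fun p _ => smul_comm _ _ _

/-- The column field of a kernel at the index `r`, expanded on the basis fields: `col_r K = Σ_p K(p, r)·δ_p`.
[cite: Balaban1983Higgs3, p.414] -/
theorem colField_eq_sum (K : HiggsLattice.Site P 0 × Fin N → HiggsLattice.Site P 0 × Fin N → ℝ) (r : HiggsLattice.Site P 0 × Fin N) :
    (fun x => WithLp.toLp 2 (fun a => K (x, a) r) : HiggsLattice.ScalarField P 0 N) = ∑ p, K p r • basisE p := by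
  rw [← sum_coord_smul_basisE (fun x => WithLp.toLp 2 (fun a => K (x, a) r))]

/-- The row field of a kernel at the index `r`: `row_r K = Σ_{p′} K(r, p′)·δ_{p′}`. [cite: Balaban1983Higgs3, p.414] -/
theorem rowField_eq_sum (K : HiggsLattice.Site P 0 × Fin N → HiggsLattice.Site P 0 × Fin N → ℝ) (r : HiggsLattice.Site P 0 × Fin N) :
    (fun x' => WithLp.toLp 2 (fun a' => K r (x', a')) : HiggsLattice.ScalarField P 0 N) = ∑ p', K r p' • basisE p' := by
  rw [← sum_coord_smul_basisE (fun x' => WithLp.toLp 2 (fun a' => K r (x', a')))]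

/-- **`dK1` IS THE COVARIANT DERIVATIVE OF THE COLUMN**: the kernel of a φ′-line differentiated at its first endpoint (FILE 6's
`dK1 K (b, u; r) = Σ_p K(p, r)·[(D^η_B̃ δ_p)(b)·u]`) equals `(D^η_B̃ K(·, r))(b)·u` — print's differentiated propagator
`(D^η_{B̃}G^η_{(j)})(Ω,B̃; b, x′)` of (2.10)/(2.11), paired with `u`. [cite: Balaban1983Higgs3, (2.11) p.426] [cite: Balaban1982Higgs1, (1.7) p.605] -/
theorem dK1_eq_inner_covDeriv (C : ChargeData N) (B : HiggsLattice.VecField P 0)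
    (K : HiggsLattice.Site P 0 × Fin N → HiggsLattice.Site P 0 × Fin N → ℝ) (b : HiggsLattice.PBond P 0) (u : HiggsCovariance.E N)
    (r : HiggsLattice.Site P 0 × Fin N) :
    dK1 C B K b u r = ⟪covDeriv C B (fun x => WithLp.toLp 2 (fun a => K (x, a) r)) b, u⟫_ℝ := by
  rw [colField_eq_sum, covDeriv_sum_smul_basisE, sum_inner]
  unfold dK1
  exact Finset.sum_congr rfl fun p _ => by rw [real_inner_smul_left]

/-- **`dK2` IS THE COVARIANT DERIVATIVE OF THE ROW**: `dK2 K (r; b′, u′) = (D^η_B̃ K(r, ·))(b′)·u′`.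
[cite: Balaban1983Higgs3, (2.11) p.426] [cite: Balaban1982Higgs1, (1.7) p.605] -/
theorem dK2_eq_inner_covDeriv (C : ChargeData N) (B : HiggsLattice.VecField P 0)
    (K : HiggsLattice.Site P 0 × Fin N → HiggsLattice.Site P 0 × Fin N → ℝ) (r : HiggsLattice.Site P 0 × Fin N)
    (b' : HiggsLattice.PBond P 0) (u' : HiggsCovariance.E N) :
    dK2 C B K r b' u' = ⟪covDeriv C B (fun x' => WithLp.toLp 2 (fun a' => K r (x', a'))) b', u'⟫_ℝ := by
  rw [rowField_eq_sum, covDeriv_sum_smul_basisE, sum_inner]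
  unfold dK2
  exact Finset.sum_congr rfl fun p _ => by rw [real_inner_smul_left]

/-- **`dKs` through `dK2`**: the doubly differentiated kernel is the first-endpoint contraction of the field of second-endpoint
kernels, `dKs K (b, u; b′, u′) = Σ_p [(D^η_B̃ δ_p)(b)·u] · dK2 K (p; b′, u′)`. [cite: Balaban1983Higgs3, (3.9) p.435] -/
theorem dKs_eq_sum_dK2 (C : ChargeData N) (B : HiggsLattice.VecField P 0)
    (K : HiggsLattice.Site P 0 × Fin N → HiggsLattice.Site P 0 × Fin N → ℝ) (b : HiggsLattice.PBond P 0) (u : HiggsCovariance.E N)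
    (b' : HiggsLattice.PBond P 0) (u' : HiggsCovariance.E N) :
    dKs C B K b u b' u' = ∑ p, dK2 C B K p b' u' * ⟪covDeriv C B (basisE p) b, u⟫_ℝ := by
  unfold dKs dK2
  refine Finset.sum_congr rfl fun p _ => ?_
  rw [Finset.sum_mul]
  exact Finset.sum_congr rfl fun p' _ => by ring

/-- **`dKs` IS THE MIXED SECOND COVARIANT DERIVATIVE**: `dKs K (b, u; b′, u′) = (D^η_B̃ [x ↦ (a ↦ (D^η_B̃ K((x,a), ·))(b′)·u′)])(b)·u` —
print's `∂^η G ∂^{η*}` of (3.9) at a general background, each derivative carrying its `(L^jη)⁻¹` in (2.10)/(2.11).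
[cite: Balaban1983Higgs3, (3.9) p.435] [cite: Balaban1983Higgs3, (2.11) p.426] -/
theorem dKs_eq_inner_covDeriv (C : ChargeData N) (B : HiggsLattice.VecField P 0)
    (K : HiggsLattice.Site P 0 × Fin N → HiggsLattice.Site P 0 × Fin N → ℝ) (b : HiggsLattice.PBond P 0) (u : HiggsCovariance.E N)
    (b' : HiggsLattice.PBond P 0) (u' : HiggsCovariance.E N) :
    dKs C B K b u b' u' = ⟪covDeriv C B (fun x => WithLp.toLp 2 (fun a => dK2 C B K (x, a) b' u')) b, u⟫_ℝ := by
  have hF : (fun x => WithLp.toLp 2 (fun a => dK2 C B K (x, a) b' u') : HiggsLattice.ScalarField P 0 N) =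
      ∑ p, dK2 C B K p b' u' • basisE p := by
    rw [← sum_coord_smul_basisE (fun x => WithLp.toLp 2 (fun a => dK2 C B K (x, a) b' u'))]
  rw [hF, covDeriv_sum_smul_basisE, sum_inner, dKs_eq_sum_dK2]
  exact Finset.sum_congr rfl fun p _ => by rw [real_inner_smul_left]

/-- **The bound that (2.10)/(2.11) feed**: `|dK1 K (b, u; r)| ≤ ‖(D^η_B̃ K(·, r))(b)‖·‖u‖` — a bound on the covariantly
DIFFERENTIATED propagator (print: (2.10) with *"an additional factor (L^jη)^{−1}"*) bounds the effective kernel of a line at a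
differentiated leg; no `η⁻¹·|G|` is ever formed. [cite: Balaban1983Higgs3, (2.10) p.426] [cite: Balaban1983Higgs3, (2.11) p.426] -/
theorem abs_dK1_le (C : ChargeData N) (B : HiggsLattice.VecField P 0)
    (K : HiggsLattice.Site P 0 × Fin N → HiggsLattice.Site P 0 × Fin N → ℝ) (b : HiggsLattice.PBond P 0) (u : HiggsCovariance.E N)
    (r : HiggsLattice.Site P 0 × Fin N) :
    |dK1 C B K b u r| ≤ ‖covDeriv C B (fun x => WithLp.toLp 2 (fun a => K (x, a) r)) b‖ * ‖u‖ := by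
  rw [dK1_eq_inner_covDeriv]
  exact abs_real_inner_le_norm _ _

/-- The same for the second endpoint: `|dK2 K (r; b′, u′)| ≤ ‖(D^η_B̃ K(r, ·))(b′)‖·‖u′‖`. [cite: Balaban1983Higgs3, (2.11) p.426] -/
theorem abs_dK2_le (C : ChargeData N) (B : HiggsLattice.VecField P 0)
    (K : HiggsLattice.Site P 0 × Fin N → HiggsLattice.Site P 0 × Fin N → ℝ) (r : HiggsLattice.Site P 0 × Fin N)
    (b' : HiggsLattice.PBond P 0) (u' : HiggsCovariance.E N) :
    |dK2 C B K r b' u'| ≤ ‖covDeriv C B (fun x' => WithLp.toLp 2 (fun a' => K r (x', a'))) b'‖ * ‖u'‖ := by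
  rw [dK2_eq_inner_covDeriv]
  exact abs_real_inner_le_norm _ _

/-- And for both endpoints: `|dKs K (b, u; b′, u′)| ≤ ‖(D^η_B̃ [x ↦ (a ↦ (D^η_B̃ K((x,a),·))(b′)·u′)])(b)‖·‖u‖` (two factors
`(L^jη)⁻¹` in (2.10)/(2.11)). [cite: Balaban1983Higgs3, (2.11) p.426] [cite: Balaban1983Higgs3, (3.9) p.435] -/
theorem abs_dKs_le (C : ChargeData N) (B : HiggsLattice.VecField P 0)
    (K : HiggsLattice.Site P 0 × Fin N → HiggsLattice.Site P 0 × Fin N → ℝ) (b : HiggsLattice.PBond P 0) (u : HiggsCovariance.E N)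
    (b' : HiggsLattice.PBond P 0) (u' : HiggsCovariance.E N) :
    |dKs C B K b u b' u'| ≤ ‖covDeriv C B (fun x => WithLp.toLp 2 (fun a => dK2 C B K (x, a) b' u')) b‖ * ‖u‖ := by
  rw [dKs_eq_inner_covDeriv]
  exact abs_real_inner_le_norm _ _

/-- **At zero background** (`U(0) = 1`): `dK1 K (b, e_c; r) = η⁻¹ (K((b₊,c), r) − K((b₋,c), r))` — the forward difference quotient
of the propagator's entries in the first variable, for ANY kernel (FILE 6's `dK1_zero_free` is the diagonal case `K = G ⊗ 1`).
[cite: Balaban1982Higgs1, (1.7) p.605] [cite: Balaban1983Higgs3, (2.11) p.426] -/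
theorem dK1_zero_single (C : ChargeData N) (K : HiggsLattice.Site P 0 × Fin N → HiggsLattice.Site P 0 × Fin N → ℝ)
    (b : HiggsLattice.PBond P 0) (c : Fin N) (r : HiggsLattice.Site P 0 × Fin N) :
    dK1 C 0 K b (EuclideanSpace.single c (1 : ℝ)) r = (P.mesh 0)⁻¹ * (K (b.tgt, c) r - K (b.src, c) r) := by
  rw [dK1_eq_inner_covDeriv, HiggsLattice.covDeriv_zero]
  unfold HiggsLattice.sderiv
  rw [real_inner_smul_left, inner_sub_left, EuclideanSpace.inner_single_right, EuclideanSpace.inner_single_right]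
  simp

/-- **The covariant forward difference, explicitly** (general background): `dK1 K (b, e_c; r) = η⁻¹((U(ηB̃_b)·K((b₊,·), r))_c −
K((b₋,c), r))` — the gauge factor `U(B̃_b)` of (I.1.7) transports the column at `b₊` before the difference is taken.
[cite: Balaban1982Higgs1, (1.7) p.605] [cite: Balaban1983Higgs3, (2.11) p.426] -/
theorem dK1_single_eq (C : ChargeData N) (B : HiggsLattice.VecField P 0)
    (K : HiggsLattice.Site P 0 × Fin N → HiggsLattice.Site P 0 × Fin N → ℝ) (b : HiggsLattice.PBond P 0) (c : Fin N)
    (r : HiggsLattice.Site P 0 × Fin N) :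
    dK1 C B K b (EuclideanSpace.single c (1 : ℝ)) r =
      (P.mesh 0)⁻¹ * ((C.U (P.mesh 0) (B b) (WithLp.toLp 2 (fun a => K (b.tgt, a) r))) c - K (b.src, c) r) := by
  rw [dK1_eq_inner_covDeriv]
  unfold covDeriv
  rw [real_inner_smul_left, inner_sub_left, EuclideanSpace.inner_single_right, EuclideanSpace.inner_single_right]
  simp

/-! ### At zero background with the free kernel `G ⊗ 1_N`: FILE 14's line hypotheses are bounds on the difference quotients of `G` -/

/-- **Zero background, free kernel, one differentiated leg**: `|dK1 (G ⊗ 1)(⟨x,μ⟩, e_{c′}; (y,c))| ≤ |(∂^η_μ G)(x, y)|` (FILE 6's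
`dKernelL`: `η⁻¹(G(x+ηe_μ, y) − G(x, y))`) — the signed position form's hypothesis for such a line is met by any bound on the
forward difference quotient of the scalar propagator, i.e. by (2.10) with its *"additional factor (L^jη)^{−1}"*.
[cite: Balaban1983Higgs3, (2.10) p.426] [cite: Balaban1983Higgs3, (3.26) p.440] -/
theorem abs_dK1_zero_free_le (C : ChargeData N) (G : HiggsLattice.Site P 0 → HiggsLattice.Site P 0 → ℝ) (x : HiggsLattice.Site P 0)
    (μ : Fin P.d) (c' : Fin N) (y : HiggsLattice.Site P 0) (c : Fin N) :
    |dK1 C 0 (fun p p' => if p.2 = p'.2 then G p.1 p'.1 else 0) ⟨x, μ⟩ (EuclideanSpace.single c' (1 : ℝ)) (y, c)| ≤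
      |B3Eq326FromFeynmanRules.dKernelL (P.mesh 0)⁻¹ μ G x y| := by
  rw [B3Eq326FromFeynmanRules.dK1_zero_free, abs_mul]
  refine mul_le_of_le_one_right (abs_nonneg _) ?_
  rw [PiLp.single_apply]
  split_ifs <;> simp

/-- **Zero background, free kernel, the second endpoint differentiated**: `|dK2 (G ⊗ 1)((y,c); ⟨x′,μ′⟩, e_{c′})| ≤ |(G∂^{η*}_{μ′})(y, x′)|`
(FILE 6's `dKernelR`). [cite: Balaban1983Higgs3, (2.10) p.426] [cite: Balaban1983Higgs3, (3.26) p.440] -/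
theorem abs_dK2_zero_free_le (C : ChargeData N) (G : HiggsLattice.Site P 0 → HiggsLattice.Site P 0 → ℝ) (y : HiggsLattice.Site P 0)
    (c : Fin N) (x' : HiggsLattice.Site P 0) (μ' : Fin P.d) (c' : Fin N) :
    |dK2 C 0 (fun p p' => if p.2 = p'.2 then G p.1 p'.1 else 0) (y, c) ⟨x', μ'⟩ (EuclideanSpace.single c' (1 : ℝ))| ≤
      |B3Eq326FromFeynmanRules.dKernelR (P.mesh 0)⁻¹ μ' G y x'| := by
  rw [B3Eq326FromFeynmanRules.dK2_zero_free, abs_mul]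
  refine mul_le_of_le_one_right (abs_nonneg _) ?_
  rw [PiLp.single_apply]
  split_ifs <;> simp

/-- **Zero background, free kernel, both endpoints differentiated**: `|dKs (G ⊗ 1)(⟨x,μ⟩, e_c; ⟨x′,μ′⟩, e_{c′})| ≤ |(∂^η_μ G ∂^{η*}_{μ′})(x, x′)|`
(FILE 6's `d2KernelT`: the four-term second difference, print's (3.9)/(3.26) kernel) — two factors `(L^jη)⁻¹` in (2.10).
[cite: Balaban1983Higgs3, (2.10) p.426] [cite: Balaban1983Higgs3, (3.9) p.435] -/
theorem abs_dKs_zero_free_le (C : ChargeData N) (G : HiggsLattice.Site P 0 → HiggsLattice.Site P 0 → ℝ) (x x' : HiggsLattice.Site P 0)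
    (μ μ' : Fin P.d) (c c' : Fin N) :
    |dKs C 0 (fun p p' => if p.2 = p'.2 then G p.1 p'.1 else 0) ⟨x, μ⟩ (EuclideanSpace.single c (1 : ℝ)) ⟨x', μ'⟩
        (EuclideanSpace.single c' (1 : ℝ))| ≤ |B3Eq326FromFeynmanRules.d2KernelT (P.mesh 0)⁻¹ μ μ' G x x'| := by
  rw [B3Eq326FromFeynmanRules.dKs_zero_free2, abs_mul]
  refine mul_le_of_le_one_right (abs_nonneg _) ?_
  rw [EuclideanSpace.inner_single_left, PiLp.single_apply]
  split_ifs <;> simp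

end

end Literature.MathematicalPhysics.QuantumFieldTheory.Balaban1983to89.B3DifferentiatedLineKernels
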